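import Summits.HodgeConjecture.CorCM.Census.OcticWeilMulti
import HarnessLib

/-!
# ANY NUMBER `r` of CM types over one OCTIC CM field: the AVERAGED EQUATION for ANY number `n` of conjugate pairs, and the octic
# DEFECT LAW from `2`-TRANSITIVITY and INDEPENDENCE of the position columns

COR-CM (cell `pub-hodgecm2`), seat b30 gen 24 (2026-08-22); count-neutral own lane OCTIC-MULTI (census half), part 2 (sequel of
`Census/OcticWeilMulti`).  One bookkeeping definition (`IndepPosO`) and theorems of the finite model; no named fact, no geometry,
no `sorry`, no `decide`.

§1 THE AVERAGED EQUATION FOR `n` PAIRS (`predMul_add_sum_eq_zero_of_twoTransitive`, generic in the number `n` of conjugate pairs,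
the slot type `M` and the sign functions `s_m` with `Σ_y s_m(y) = σ_m`; gen 23's `DecicWeil23Triple.fourMul_add_sum_eq_zero_of_twoTransitive'`
is the case `n = 5`).  For `R ⊆ Sym(n)` closed under composition and `2`-transitive and unknowns with
`e + Σ_m Σ_a s_m(π a) d_{m,a} = 0` at every `π ∈ R`:  `(n−1)·e + Σ_m Σ_a (a = b ? (n−1)·s_m(x) : σ_m − s_m(x))·d_{m,a} = 0` for all
`b, x` — left translation equalises the double fibres `{π | π b = x, π a = y}` (`y ≠ x`), the simple fibre has `(n−1)` times their
size, and one sums the equation over a simple fibre.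
§2 FOUR PAIRS (octic `K ∋ k`).  Positions `P : Fin r → Fin 4 → Bool` of weights `#I_m = w_m` (`w_m = 2`: a `(2,2)`-type, `w_m = 1`:
a `(1,3)`-type; `σ_m = 2w_m − 4`).  Summing out `a`: `W_b + Σ_{m ∋ x} T_{m,b} = 0` with `T_{m,b} = 8 d_{m,b} − 2 Σ_a d_{m,a}`; under
**`IndepPosO P`** (the columns `𝟙, 𝟙_{I_1}, …, 𝟙_{I_r}` of `ℤ⁴` independent — so `r ≤ 3`) this gives THE DEFECT LAW
`d_{m,a} = d_{m,0}` AND `e = Σ_m (4 − 2w_m)·d_{m,0}` (`defectO_of_signed_twoTransitive`): the `(2,2)`-slots do not feed the curve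
defect, each `(1,3)`-slot feeds it twice — gens 20/21's tabulated laws (`e = 2·d_{2,0}`, `e = 2t₁ + 2t₂`) for ARBITRARY positions.
Conversely the defect law gives the signed equation at EVERY permutation (`signedO_of_defectO`); `exists_defectO_of_modelBalancedO`,
`balancedO_of_defect`.
[cite: DixonMortimer1996, §2.1] [cite: MoonenZarhin1995Duke, Thm. 2.4] [cite: GaoUllmo2025, Thm 3.1] [cite: Pohlmann1968, Thm 1]

## References
* [DixonMortimer1996] J. D. Dixon, B. Mortimer, *Permutation Groups*, GTM 163 (1996), §2.1.  [MoonenZarhin1995Duke] B. Moonen,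
  Yu. Zarhin, Duke Math. J. 77 (1995), Thm. 2.4.  [GaoUllmo2025] Z. Gao, E. Ullmo, J. Inst. Math. Jussieu 25 (2025), Thm 3.1.
  [Pohlmann1968] H. Pohlmann, Ann. of Math. 88 (1968), Thm 1.
-/

namespace Summit.HodgeConjecture.CorCM.Census.OcticWeilMulti

open Finset

/-! ## §1 The averaged equation for `n` conjugate pairs -/

section Generic

variable {n : ℕ} (R : Finset (Equiv.Perm (Fin n)))

/-- **Left translation** by `h ∈ R` maps the double fibre `{π ∈ R | π b = x, π a = y}` injectively into the double fibre over
`(h x, h y)` (`R` closed under composition). [cite: DixonMortimer1996, §2.1] -/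
theorem card_filter₂_le_of_mem (hmul : ∀ π₁ ∈ R, ∀ π₂ ∈ R, π₁ * π₂ ∈ R) {h : Equiv.Perm (Fin n)} (hh : h ∈ R)
    (b a x y : Fin n) :
    (R.filter fun π => π b = x ∧ π a = y).card ≤ (R.filter fun π => π b = h x ∧ π a = h y).card := by
  refine Finset.card_le_card_of_injOn (fun π => h * π) (fun π hπ => ?_) (fun π₁ _ π₂ _ h12 => mul_left_cancel h12)
  rw [Finset.mem_coe, Finset.mem_filter] at hπ
  rw [Finset.mem_coe, Finset.mem_filter]
  exact ⟨hmul h hh π hπ.1, by rw [Equiv.Perm.mul_apply, hπ.2.1], by rw [Equiv.Perm.mul_apply, hπ.2.2]⟩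

/-- **All off-diagonal double fibres have one size** (`R` closed under composition and `2`-transitive).
[cite: DixonMortimer1996, §2.1] -/
theorem card_filter₂_eq (hmul : ∀ π₁ ∈ R, ∀ π₂ ∈ R, π₁ * π₂ ∈ R)
    (h2 : ∀ a b x y : Fin n, a ≠ b → x ≠ y → ∃ π ∈ R, π a = x ∧ π b = y)
    (b a : Fin n) {x y x' y' : Fin n} (hxy : x ≠ y) (hxy' : x' ≠ y') :
    (R.filter fun π => π b = x ∧ π a = y).card = (R.filter fun π => π b = x' ∧ π a = y').card := by
  apply le_antisymm
  · obtain ⟨h, hh, hx, hy⟩ := h2 x y x' y' hxy hxy'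
    have key := card_filter₂_le_of_mem R hmul hh b a x y
    rwa [hx, hy] at key
  · obtain ⟨h, hh, hx, hy⟩ := h2 x' y' x y hxy' hxy
    have key := card_filter₂_le_of_mem R hmul hh b a x' y'
    rwa [hx, hy] at key

/-- The diagonal double fibres `{π | π b = x, π a = x}` are empty for `a ≠ b`. [folklore] -/
theorem card_filter₂_diag {b a : Fin n} (hab : a ≠ b) (x : Fin n) :
    (R.filter fun π => π b = x ∧ π a = x).card = 0 := by
  rw [Finset.card_eq_zero, Finset.filter_eq_empty_iff]
  rintro π - ⟨hb, ha⟩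
  exact hab (π.injective (ha.trans hb.symm))

/-- The simple fibre `{π ∈ R | π b = x}` is the disjoint union over `y` of the double fibres. [folklore] -/
theorem card_filter_eq_sum_card_filter₂ (b a x : Fin n) :
    (R.filter fun π => π b = x).card = ∑ y : Fin n, (R.filter fun π => π b = x ∧ π a = y).card := by
  rw [Finset.card_eq_sum_card_fiberwise (f := fun π : Equiv.Perm (Fin n) => π a) (t := univ)
    (fun _ _ => Finset.mem_coe.2 (Finset.mem_univ _))]
  refine Finset.sum_congr rfl fun y _ => ?_
  rw [Finset.filter_filter]

/-- Summing a function of `π a` over the simple fibre, fibrewise. [folklore] -/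
theorem sum_filter_apply_eq (b a x : Fin n) (f : Fin n → ℤ) :
    ∑ π ∈ R.filter (fun π => π b = x), f (π a) =
      ∑ y : Fin n, ((R.filter fun π => π b = x ∧ π a = y).card : ℤ) * f y := by
  rw [← Finset.sum_fiberwise' (R.filter fun π => π b = x) (fun π : Equiv.Perm (Fin n) => π a) f]
  refine Finset.sum_congr rfl fun y _ => ?_
  rw [Finset.sum_const, Finset.filter_filter, nsmul_eq_mul]

variable {M : Type*} [Fintype M]

/-- **THE AVERAGED EQUATION FOR `n` CONJUGATE PAIRS** (generic slots and signs).  `R ⊆ Sym(n)` closed under composition and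
`2`-transitive (`n ≥ 2` implicitly: some `a ≠ b`); sign functions `s_m` with `Σ_y s_m(y) = σ_m`; if
`e + Σ_m Σ_a s_m(π a) d_{m,a} = 0` at every `π ∈ R` then for all `b, x`:
`(n−1)·e + Σ_m Σ_a (a = b ? (n−1)·s_m(x) : σ_m − s_m(x)) · d_{m,a} = 0`. [cite: DixonMortimer1996, §2.1] [cite: MoonenZarhin1995Duke, Thm. 2.4] -/
theorem predMul_add_sum_eq_zero_of_twoTransitive (s : M → Fin n → ℤ) (σ : M → ℤ) (hs : ∀ m, ∑ y : Fin n, s m y = σ m)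
    (hmul : ∀ π₁ ∈ R, ∀ π₂ ∈ R, π₁ * π₂ ∈ R) (h2 : ∀ a b x y : Fin n, a ≠ b → x ≠ y → ∃ π ∈ R, π a = x ∧ π b = y)
    (e : ℤ) (d : M → Fin n → ℤ) (h : ∀ π ∈ R, e + ∑ m, ∑ a : Fin n, s m (π a) * d m a = 0) {b a₀ : Fin n} (hab : a₀ ≠ b)
    (x : Fin n) :
    ((n : ℤ) - 1) * e + ∑ m, ∑ a : Fin n, (if a = b then ((n : ℤ) - 1) * s m x else σ m - s m x) * d m a = 0 := by
  have hn1 : ((n - 1 : ℕ) : ℤ) = (n : ℤ) - 1 := by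
    rw [Nat.cast_sub (Fin.pos x), Nat.cast_one]
  obtain ⟨y₀, hy₀⟩ : ∃ y₀ : Fin n, y₀ ≠ x := ⟨if x = a₀ then b else a₀, by split_ifs with hx <;> [exact hx ▸ hab.symm; exact Ne.symm hx]⟩
  set F : Finset (Equiv.Perm (Fin n)) := R.filter fun π => π b = x with hF
  set N : ℕ := (R.filter fun π => π b = x ∧ π a₀ = y₀).card with hN₀
  have hfib : ∀ a, a ≠ b → ∀ y₁, y₁ ≠ x → F.card = (n - 1) * (R.filter fun π => π b = x ∧ π a = y₁).card := by
    intro a ha y₁ hy₁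
    rw [hF, card_filter_eq_sum_card_filter₂ R b a x, ← Finset.sum_erase_add _ _ (Finset.mem_univ x),
      card_filter₂_diag R ha x, add_zero]
    have hc : ∀ y ∈ (univ : Finset (Fin n)).erase x, (R.filter fun π => π b = x ∧ π a = y).card =
        (R.filter fun π => π b = x ∧ π a = y₁).card := fun y hy =>
      card_filter₂_eq R hmul h2 b a (Finset.ne_of_mem_erase hy).symm hy₁.symm
    rw [Finset.sum_congr rfl hc, Finset.sum_const, smul_eq_mul, Finset.card_erase_of_mem (Finset.mem_univ x),
      Finset.card_univ, Fintype.card_fin]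
  have hN : F.card = (n - 1) * N := hfib a₀ hab y₀ hy₀
  have hpos : 0 < N := by
    obtain ⟨π, hπ, hb, ha⟩ := h2 b a₀ x y₀ hab.symm hy₀.symm
    exact Finset.card_pos.2 ⟨π, Finset.mem_filter.2 ⟨hπ, hb, ha⟩⟩
  have hn₂ : ∀ a, a ≠ b → ∀ y, y ≠ x → (R.filter fun π => π b = x ∧ π a = y).card = N := by
    intro a ha y hy
    have h1 := hfib a ha y hy
    rw [hN] at h1
    have hn0 : 0 < n - 1 := by
      have := Fin.pos x
      have hne : (1 : ℕ) < n := by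
        by_contra hle
        push Not at hle
        have : a₀ = b := Fin.ext (by have := a₀.isLt; have := b.isLt; omega)
        exact hab this
      omega
    exact (Nat.eq_of_mul_eq_mul_left hn0 h1).symm
  have hsum : ∑ π ∈ F, (e + ∑ m, ∑ a : Fin n, s m (π a) * d m a) = 0 :=
    Finset.sum_eq_zero fun π hπ => h π (Finset.mem_filter.1 hπ).1
  have hswap : ∑ π ∈ F, ∑ m, ∑ a : Fin n, s m (π a) * d m a = ∑ m, ∑ a : Fin n, (∑ π ∈ F, s m (π a)) * d m a := by
    rw [Finset.sum_comm]
    refine Finset.sum_congr rfl fun m _ => ?_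
    rw [Finset.sum_comm]
    refine Finset.sum_congr rfl fun a _ => ?_
    rw [Finset.sum_mul]
  have hinner : ∀ m (a : Fin n), ∑ π ∈ F, s m (π a) =
      if a = b then (((n - 1) * N : ℕ) : ℤ) * s m x else (N : ℤ) * (σ m - s m x) := by
    intro m a
    by_cases hab' : a = b
    · rw [if_pos hab', hab', Finset.sum_congr rfl fun π hπ => by rw [(Finset.mem_filter.1 hπ).2], Finset.sum_const,
        nsmul_eq_mul, hN]
    · rw [if_neg hab', hF, sum_filter_apply_eq R b a x (s m), ← Finset.sum_erase_add _ _ (Finset.mem_univ x),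
        card_filter₂_diag R hab' x, Nat.cast_zero, zero_mul, add_zero,
        Finset.sum_congr rfl fun y hy => by rw [hn₂ a hab' y (Finset.ne_of_mem_erase hy)], ← Finset.mul_sum,
        Finset.sum_erase_eq_sub (Finset.mem_univ x), hs]
  rw [Finset.sum_add_distrib, Finset.sum_const, nsmul_eq_mul, hswap,
    Finset.sum_congr rfl fun m _ => Finset.sum_congr rfl fun a _ => by rw [hinner m a], hN] at hsum
  have hfactor : (((n - 1) * N : ℕ) : ℤ) * e +
      ∑ m, ∑ a : Fin n, (if a = b then (((n - 1) * N : ℕ) : ℤ) * s m x else (N : ℤ) * (σ m - s m x)) * d m a =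
      (N : ℤ) * (((n : ℤ) - 1) * e + ∑ m, ∑ a : Fin n, (if a = b then ((n : ℤ) - 1) * s m x else σ m - s m x) * d m a) := by
    rw [mul_add, Finset.mul_sum]
    push_cast
    rw [hn1]
    congr 1
    · ring
    · refine Finset.sum_congr rfl fun m _ => ?_
      rw [Finset.mul_sum]
      refine Finset.sum_congr rfl fun a _ => ?_
      split_ifs <;> ring
  rw [hfactor] at hsum
  exact (mul_eq_zero.1 hsum).resolve_left (by exact_mod_cast hpos.ne')

/-- `Σ_a (a = b ? α : β) · f a = (α − β) f b + β Σ_a f a` (any number of pairs). [folklore] -/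
theorem sum_ite_mul_eq (b : Fin n) (α β : ℤ) (f : Fin n → ℤ) :
    ∑ a : Fin n, (if a = b then α else β) * f a = (α - β) * f b + β * ∑ a : Fin n, f a := by
  rw [Finset.sum_congr rfl fun a _ => show (if a = b then α else β) * f a =
    (if a = b then (α - β) * f a else 0) + β * f a by split_ifs <;> ring, Finset.sum_add_distrib,
    Finset.sum_ite_eq' Finset.univ b, if_pos (Finset.mem_univ b), ← Finset.mul_sum]

end Generic

/-! ## §2 Four pairs: the independence criterion and the defect law -/

variable {r : ℕ}

/-- **THE INDEPENDENCE CRITERION (four pairs)**: the columns `𝟙, 𝟙_{I_1}, …, 𝟙_{I_r}` of `ℤ⁴` are linearly independent —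
`w + Σ_{m ∋ x} t_m = 0` for all four `x` forces `w = t = 0` (so `r ≤ 3`). [cite: MoonenZarhin1995Duke, Thm. 2.4] -/
def IndepPosO (P : Fin r → Fin 4 → Bool) : Prop :=
  ∀ (w : ℤ) (t : Fin r → ℤ), (∀ x : Fin 4, w + ∑ m : Fin r, (if P m x then t m else 0) = 0) → w = 0 ∧ ∀ m, t m = 0

/-- The sign `ε_m(y) = ±1` of the pair `y` for the type of slot `m` at positions `P`. [folklore] -/
def sgnO (P : Fin r → Fin 4 → Bool) (m : Fin r) (y : Fin 4) : ℤ := if P m y then 1 else -1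

variable (P : Fin r → Fin 4 → Bool)

/-- `± t = ε_m(y) · t`. [folklore] -/
theorem ite_eq_sgnO_mul (m : Fin r) (y : Fin 4) (t : ℤ) : (if P m y then t else -t) = sgnO P m y * t := by
  unfold sgnO
  split_ifs <;> ring

/-- `Σ_y ε_m(y) = w − (4 − w) = 2w − 4` for a position set of weight `w`. [folklore] -/
theorem sum_sgnO {m : Fin r} {w : ℕ} (hP : ((univ : Finset (Fin 4)).filter fun a => P m a = true).card = w) :
    ∑ y : Fin 4, sgnO P m y = 2 * (w : ℤ) - 4 := by
  have h4 : ((univ : Finset (Fin 4)).filter fun a => P m a = true).card +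
      ((univ : Finset (Fin 4)).filter fun a => ¬ P m a = true).card = 4 := by
    rw [Finset.card_filter_add_card_filter_not, Finset.card_univ, Fintype.card_fin]
  unfold sgnO
  rw [Finset.sum_ite, Finset.sum_const, Finset.sum_const, nsmul_eq_mul, nsmul_eq_mul]
  have h4' : (((univ : Finset (Fin 4)).filter fun a => ¬ P m a = true).card : ℤ) = 4 - w := by
    rw [← hP]; omega
  rw [hP, h4']
  ring

/-- Summing out `a` in the averaged equation of slot `m` (weight `w`, `σ = 2w − 4`):
`(−2w) f b + (2w − 3) Σ_a f a + (x ∈ I_m ? 8 f b − 2 Σ_a f a : 0)`. [folklore] -/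
theorem sum_probe_termO (m : Fin r) (x b : Fin 4) (f : Fin 4 → ℤ) (w : ℤ) :
    ∑ a : Fin 4, (if a = b then 3 * sgnO P m x else (2 * w - 4) - sgnO P m x) * f a =
      (-2 * w) * f b + (2 * w - 3) * ∑ a : Fin 4, f a + (if P m x then 8 * f b - 2 * ∑ a : Fin 4, f a else 0) := by
  rw [sum_ite_mul_eq]
  unfold sgnO
  split_ifs <;> ring

variable (R : Finset (Equiv.Perm (Fin 4)))

/-- **THE OCTIC DEFECT LAW FROM `2`-TRANSITIVITY AND INDEPENDENCE (any number of types, any positions).**  For `R ⊆ Sym(4)`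
closed under composition and `2`-transitive, positions `P` of weights `#I_m = w_m` with `IndepPosO P`, the signed equations
`e + Σ_{m,a} ± d_{m,a} = 0` (sign `+` iff `π a ∈ I_m`) at all `π ∈ R` force `d_{m,a} = d_{m,0}` for all `m, a` AND
`e = Σ_m (4 − 2w_m)·d_{m,0}`. [cite: MoonenZarhin1995Duke, Thm. 2.4] [cite: GaoUllmo2025, Thm 3.1] [cite: DixonMortimer1996, §2.1] -/
theorem defectO_of_signed_twoTransitive (w : Fin r → ℕ) (hP : ∀ m, ((univ : Finset (Fin 4)).filter fun a => P m a = true).card = w m)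
    (hind : IndepPosO P) (hmul : ∀ π₁ ∈ R, ∀ π₂ ∈ R, π₁ * π₂ ∈ R)
    (h2 : ∀ a b x y : Fin 4, a ≠ b → x ≠ y → ∃ π ∈ R, π a = x ∧ π b = y) (e : ℤ) (d : Fin r → Fin 4 → ℤ)
    (h : ∀ π ∈ R, e + ∑ m : Fin r, ∑ a : Fin 4, (if P m (π a) then d m a else -d m a) = 0) :
    (∀ (m : Fin r) (a : Fin 4), d m a = d m 0) ∧ e = ∑ m : Fin r, (4 - 2 * (w m : ℤ)) * d m 0 := by
  have h' : ∀ π ∈ R, e + ∑ m : Fin r, ∑ a : Fin 4, sgnO P m (π a) * d m a = 0 := by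
    intro π hπ
    rw [← h π hπ]
    simp only [ite_eq_sgnO_mul]
  have h3 : ((4 : ℕ) : ℤ) - 1 = 3 := by norm_num
  -- the probe equations in the form `W_b + Σ_{m ∋ x} T_{m,b} = 0`
  have hx : ∀ b x : Fin 4, (3 * e + ∑ m : Fin r, ((-2 * (w m : ℤ)) * d m b + (2 * (w m : ℤ) - 3) * ∑ a : Fin 4, d m a)) +
      ∑ m : Fin r, (if P m x then 8 * d m b - 2 * ∑ a : Fin 4, d m a else 0) = 0 := by
    intro b x
    obtain ⟨a₀, ha₀⟩ := exists_ne b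
    have hb := predMul_add_sum_eq_zero_of_twoTransitive R (sgnO P) (fun m => 2 * (w m : ℤ) - 4)
      (fun m => sum_sgnO P (hP m)) hmul h2 e d h' ha₀ x
    rw [h3] at hb
    simp only [sum_probe_termO, Finset.sum_add_distrib] at hb
    rw [Finset.sum_add_distrib]
    linarith
  have ht : ∀ b : Fin 4, (3 * e + ∑ m : Fin r, ((-2 * (w m : ℤ)) * d m b + (2 * (w m : ℤ) - 3) * ∑ a : Fin 4, d m a)) = 0 ∧
      ∀ m : Fin r, 8 * d m b - 2 * ∑ a : Fin 4, d m a = 0 := fun b => hind _ _ (hx b)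
  have hd : ∀ (m : Fin r) (b : Fin 4), 4 * d m b = ∑ a : Fin 4, d m a := by
    intro m b
    have h₁ := (ht b).2 m
    linarith
  have hd' : ∀ (m : Fin r) (a : Fin 4), d m a = d m 0 := by
    intro m a
    have h₁ := hd m a; have h₂ := hd m 0
    linarith
  refine ⟨hd', ?_⟩
  have h₁ := (ht 0).1
  have hsum : ∑ m : Fin r, ((-2 * (w m : ℤ)) * d m 0 + (2 * (w m : ℤ) - 3) * ∑ a : Fin 4, d m a) =
      ∑ m : Fin r, (6 * (w m : ℤ) - 12) * d m 0 := by
    refine Finset.sum_congr rfl fun m _ => ?_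
    rw [← hd m 0]
    ring
  rw [hsum] at h₁
  have h3 : 3 * (e - ∑ m : Fin r, (4 - 2 * (w m : ℤ)) * d m 0) = 0 := by
    rw [mul_sub, Finset.mul_sum, Finset.sum_congr rfl fun m _ => show 3 * ((4 - 2 * (w m : ℤ)) * d m 0) =
      -((6 * (w m : ℤ) - 12) * d m 0) by ring, Finset.sum_neg_distrib]
    linarith
  linarith

/-- **Conversely, the defect law gives the signed equation at EVERY permutation of the pairs.** [folklore] -/
theorem signedO_of_defectO (w : Fin r → ℕ) (hP : ∀ m, ((univ : Finset (Fin 4)).filter fun a => P m a = true).card = w m)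
    (π : Equiv.Perm (Fin 4)) {e : ℤ} {d : Fin r → Fin 4 → ℤ}
    (hd : ∀ (m : Fin r) (a : Fin 4), d m a = d m 0) (he : e = ∑ m : Fin r, (4 - 2 * (w m : ℤ)) * d m 0) :
    e + ∑ m : Fin r, ∑ a : Fin 4, (if P m (π a) then d m a else -d m a) = 0 := by
  have key : ∀ m : Fin r, ∑ a : Fin 4, (if P m (π a) then d m a else -d m a) = (2 * (w m : ℤ) - 4) * d m 0 := by
    intro m
    rw [Finset.sum_congr rfl fun a _ => by rw [hd m a, ite_eq_sgnO_mul], ← Finset.sum_mul,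
      Equiv.sum_comp π (sgnO P m), sum_sgnO P (hP m)]
  rw [Finset.sum_congr rfl fun m _ => key m, he, ← Finset.sum_add_distrib]
  exact Finset.sum_eq_zero fun m _ => by ring

/-! ## §3 The defect law for balanced configurations -/

variable {α : Type*} {P R} {v : α → PtO r}

/-- **THE DEFECT LAW OF A BALANCED CONFIGURATION** (input of extraction): there are integers `t_m` with
`N(m, a, +) − N(m, a, −) = t_m` for all `m, a` and `N(τ) − N(τ̄) = Σ_m (4 − 2w_m)·t_m`. [cite: MoonenZarhin1995Duke, Thm. 2.4]
[cite: GaoUllmo2025, Thm 3.1] -/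
theorem exists_defectO_of_modelBalancedO (w : Fin r → ℕ)
    (hP : ∀ m, ((univ : Finset (Fin 4)).filter fun a => P m a = true).card = w m)
    (hind : IndepPosO P) (hmul : ∀ π₁ ∈ R, ∀ π₂ ∈ R, π₁ * π₂ ∈ R)
    (h2 : ∀ a b x y : Fin 4, a ≠ b → x ≠ y → ∃ π ∈ R, π a = x ∧ π b = y) {T : Finset α} (hT : ModelBalancedO P R v T) :
    ∃ t : Fin r → ℤ, (∀ (m : Fin r) (a : Fin 4), ((T.filter fun x => v x = Sum.inr (m, (a, true))).card : ℤ) -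
        (T.filter fun x => v x = Sum.inr (m, (a, false))).card = t m) ∧
      ((T.filter fun x => v x = Sum.inl true).card : ℤ) - (T.filter fun x => v x = Sum.inl false).card =
        ∑ m : Fin r, (4 - 2 * (w m : ℤ)) * t m := by
  obtain ⟨hd, he⟩ := defectO_of_signed_twoTransitive P R w hP hind hmul h2 _
    (fun m a => ((T.filter fun x => v x = Sum.inr (m, (a, true))).card : ℤ) -
      (T.filter fun x => v x = Sum.inr (m, (a, false))).card) fun π hπ => signed_of_modelBalancedO P R v hT hπ
  exact ⟨fun m => ((T.filter fun x => v x = Sum.inr (m, ((0 : Fin 4), true))).card : ℤ) -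
      (T.filter fun x => v x = Sum.inr (m, ((0 : Fin 4), false))).card, fun m a => hd m a, he⟩

/-- **A configuration whose fibre counts obey the defect law is balanced at every permutation** (used for the generating parts).
[folklore] -/
theorem balancedO_of_defect (w : Fin r → ℕ) (hP : ∀ m, ((univ : Finset (Fin 4)).filter fun a => P m a = true).card = w m)
    {T : Finset α} (π : Equiv.Perm (Fin 4)) (t : Fin r → ℤ)
    (hd : ∀ (m : Fin r) (a : Fin 4), ((T.filter fun x => v x = Sum.inr (m, (a, true))).card : ℤ) -
      (T.filter fun x => v x = Sum.inr (m, (a, false))).card = t m)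
    (he : ((T.filter fun x => v x = Sum.inl true).card : ℤ) - (T.filter fun x => v x = Sum.inl false).card =
      ∑ m : Fin r, (4 - 2 * (w m : ℤ)) * t m) :
    2 * (T.filter fun x => v x ∈ phiO P π).card = T.card :=
  balancedO_of_signed (P := P) v (signedO_of_defectO P w hP π
    (d := fun m a => ((T.filter fun x => v x = Sum.inr (m, (a, true))).card : ℤ) -
      (T.filter fun x => v x = Sum.inr (m, (a, false))).card)
    (fun m a => by rw [hd m a, hd m 0]) (by rw [he]; exact Finset.sum_congr rfl fun m _ => by rw [hd m 0]))

/-- **`R`-BALANCED ⟹ BALANCED AT EVERY PERMUTATION** (four pairs). [cite: MoonenZarhin1995Duke, Thm. 2.4] -/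
theorem balancedO_of_modelBalancedO (w : Fin r → ℕ) (hP : ∀ m, ((univ : Finset (Fin 4)).filter fun a => P m a = true).card = w m)
    (hind : IndepPosO P) (hmul : ∀ π₁ ∈ R, ∀ π₂ ∈ R, π₁ * π₂ ∈ R)
    (h2 : ∀ a b x y : Fin 4, a ≠ b → x ≠ y → ∃ π ∈ R, π a = x ∧ π b = y) {T : Finset α}
    (hT : ModelBalancedO P R v T) (π : Equiv.Perm (Fin 4)) : 2 * (T.filter fun x => v x ∈ phiO P π).card = T.card := by
  obtain ⟨t, ht, he⟩ := exists_defectO_of_modelBalancedO w hP hind hmul h2 hT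
  exact balancedO_of_defect w hP π t ht he

end Summit.HodgeConjecture.CorCM.Census.OcticWeilMulti
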